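import Summits.QuantumFields.YangMills.Theorems.CovariantDischargeTruncatedPotentialTorus
import Summits.QuantumFields.YangMills.Theorems.CovariantDischargeMatchedPairCharge
import HarnessLib

/-!
# Line «sandwich_discharge» on crux `HistoryTailL` (stmt-QuantumFields-19936), stub `stub_sandwichSweepGapCapped` (S′) —
# (Z-e) FILE 8 «THE PROFILE SOCKET»: FILE 5 (the transplanted truncated potential) AT FILE 7's matched counting charge of a level-`j` block inside a
# level-`h` block of the member `F.P K` — ONE theorem, hypotheses = the geometric data only, the pairing row already written against the two one-stroke
# sums of ✓(M2) `circ_bondAvgIter_eq_sum` (heights `j` and `h`), all masses in closed form (`4L^{2j}`, `24L^{2j}L^h`, `8L^j`, `2L^{−j}`)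

Cell `ym3-torus` (YM ladder rung R3 = continuum SU(2) Yang–Mills on the three-torus — a RUNG, NOT the Clay problem: not d = 4, not infinite volume,
not a mass gap); width seat `ym3-torus-px8` gen 7; `--supports stmt-QuantumFields-19936` (helper).  THEOREMS ONLY (0 `def`, default heartbeats).
This is the socket the B6 pen (ARCH-S′ v2, 19936 evidence #59, rows (R3)–(R5)) plugs ✓(M2)∕✓(M3), the window hypothesis and the COARSER conjunct into.
HONEST SCOPE: assembly of FILES 5–7; NOTHING here proves B4's `θ`-arithmetic, B6, the capped stub, `HistoryTailL`, or any summit statement; YM₃ on T³ is rung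
R3, not Clay. [folklore]
-/

noncomputable section

open scoped BigOperators
open Finset

namespace Summit.QuantumFields.YangMills.Theorems.CovariantDischargeProfileSocket

open Literature.MathematicalPhysics.QuantumFieldTheory.Balaban1983to89
open Literature.MathematicalPhysics.QuantumFieldTheory.Balaban1983to89.T3ContinuumYM3Torus
open Literature.MathematicalPhysics.QuantumFieldTheory.Balaban1983to89.B4Eq19LatticeOperators (Zd box mem_box unitVec box_mono self_mem_box)
open B5Eq118OneStroke (iterBlock)
open LatticeFieldCalculus (runSite)
open B10Eq27TorusAxialLog (transl)
open Summit.QuantumFields.YangMills.Theorems.CovariantDischargeTruncatedPotentialTorus (exists_truncatedPotential_torus)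
open Summit.QuantumFields.YangMills.Theorems.CovariantDischargeMatchedPairCharge (matched_counting_data sum_matched_mul_eq firstMoment_le_of_box)

/-! ## §1 Two small letters -/

/-- `Σ f² ≤ (sup|f|)·Σ|f|`. [folklore] -/
theorem sum_sq_le_sup_mul_sum_abs {ι : Type*} (s : Finset ι) (f : ι → ℝ) {H : ℝ} (hH : ∀ i ∈ s, |f i| ≤ H) :
    ∑ i ∈ s, f i ^ 2 ≤ H * ∑ i ∈ s, |f i| := by
  rw [Finset.mul_sum]
  refine Finset.sum_le_sum fun i hi => ?_
  rw [← sq_abs, sq]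
  exact mul_le_mul_of_nonneg_right (hH i hi) (abs_nonneg _)

/-- The corner of a block exists as a fine site: `val(C_i) = val(Y_i)·L^h` (standing range). [folklore] -/
theorem exists_corner (F : T3Family) (K : ℕ) {h : ℕ} (hh : h ≤ (F.P K).m + (F.P K).K) (Y : Site (F.P K) h) :
    ∃ C : Site (F.P K) 0, ∀ i, (C i).val = (Y i).val * (F.P K).L ^ h := by
  have hN : (F.P K).sitesPerDir 0 = (F.P K).sitesPerDir h * (F.P K).L ^ h := by
    show 2 * (F.P K).L ^ ((F.P K).m + (F.P K).K - 0) = 2 * (F.P K).L ^ ((F.P K).m + (F.P K).K - h) * (F.P K).L ^ h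
    rw [Nat.sub_zero, mul_assoc, ← pow_add, Nat.sub_add_cancel hh]
  haveI : NeZero ((F.P K).sitesPerDir 0) := ⟨(F.P K).sitesPerDir_ne_zero 0⟩
  refine ⟨fun i => ((((Y i).val * (F.P K).L ^ h : ℕ)) : ZMod ((F.P K).sitesPerDir 0)), fun i => ?_⟩
  rw [ZMod.val_natCast, Nat.mod_eq_of_lt]
  have hy : (Y i).val + 1 ≤ (F.P K).sitesPerDir h := ZMod.val_lt (Y i)
  have h1 := Nat.mul_le_mul_right ((F.P K).L ^ h) hy
  have hL : 0 < (F.P K).L ^ h := pow_pos (F.P K).L_pos h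
  rw [hN]; rw [Nat.add_mul, one_mul] at h1; omega

/-! ## §2 The profile socket -/

/-- ★★★ **THE PROFILE SOCKET** — see the module docstring.  Data: member `F`, level `K`, heights `j ≤ h ≤ m + K`, a level-`j` site `y` inside the
level-`h` site `Y` (`hnest`), plaquette directions `μ ≠ ν`, truncation radius `R ≥ max 12 (4L^h + 4)` with the injectivity side condition
`2(2R+3)+1 ≤ sitesPerDir 0`.  Output: the coarse corner `C` and a real bond function `aT` on `T^{(0)}` with (0′) support, (P″) the pairing row against the two
one-stroke sums at `(y;μ,ν)` and `(Y;μ,ν)`, (Q″) cost, (S″) ℓ¹ mass, (T″) sup — constants absolute, masses in closed form. [folklore] -/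
theorem exists_profile_socket : ∃ A_S A_B A_B' A_Q A_L A_L' A_T : ℝ,
    0 ≤ A_S ∧ 0 ≤ A_B ∧ 0 ≤ A_B' ∧ 0 ≤ A_Q ∧ 0 ≤ A_L ∧ 0 ≤ A_L' ∧ 0 ≤ A_T ∧
    ∀ (F : T3Family) (K j h : ℕ), j ≤ h → h ≤ (F.P K).m + (F.P K).K →
    ∀ (μ ν : Fin (F.P K).d), μ ≠ ν → ∀ (y : Site (F.P K) j) (Y : Site (F.P K) h),
      (∀ i, (y i).val / (F.P K).L ^ (h - j) = (Y i).val) →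
    ∀ (R : ℕ), 2 * (2 * (F.P K).L ^ h) + 4 ≤ R → 12 ≤ R → 2 * (2 * (R : ℤ) + 3) + 1 ≤ ((F.P K).sitesPerDir 0 : ℤ) →
      ∃ (C : Site (F.P K) 0) (aT : PBond (F.P K) 0 → ℝ),
        (∀ i, (C i).val = (Y i).val * (F.P K).L ^ h) ∧
        (∀ b : PBond (F.P K) 0, (∀ w ∈ box (0 : Zd (F.P K).d) (2 * (R : ℤ)), transl C w ≠ b.src) → aT b = 0) ∧
        (∀ (Φ : Site (F.P K) 0 → Fin (F.P K).d → Fin (F.P K).d → ℝ) (θ η : ℝ), 0 ≤ θ → (∀ x a b, Φ x b a = -Φ x a b) →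
          (∀ w ∈ box (0 : Zd (F.P K).d) (2 * (R : ℤ) + 2), ∀ a b, |Φ (transl C w) a b| ≤ θ) →
          (∀ w ∈ box (0 : Zd (F.P K).d) (2 * (R : ℤ)), ∀ κ a b,
            |(Φ (transl C (w + unitVec κ)) a b - Φ (transl C w) a b) - (Φ (transl C (w + unitVec a)) κ b - Φ (transl C w) κ b)
              + (Φ (transl C (w + unitVec b)) κ a - Φ (transl C w) κ a)| ≤ η) →
          |(∑ x : Site (F.P K) 0, ∑ a, ∑ b, ((aT ⟨x.shift a, b⟩ - aT ⟨x, b⟩) - (aT ⟨x.shift b, a⟩ - aT ⟨x, a⟩)) * Φ x a b)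
              - (2 * ((((F.P K).L : ℝ) ^ (F.P K).d) ^ j)⁻¹ *
                  (∑ x ∈ iterBlock j y, ∑ s ∈ Finset.range ((F.P K).L ^ j), ∑ t ∈ Finset.range ((F.P K).L ^ j), Φ (runSite (runSite x μ s) ν t) μ ν)
                - ((((F.P K).L : ℝ) ^ j) ^ 2 / (((F.P K).L : ℝ) ^ h) ^ 2) * (2 * ((((F.P K).L : ℝ) ^ (F.P K).d) ^ h)⁻¹ *
                  (∑ x ∈ iterBlock h Y, ∑ s ∈ Finset.range ((F.P K).L ^ h), ∑ t ∈ Finset.range ((F.P K).L ^ h), Φ (runSite (runSite x μ s) ν t) μ ν)))|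
            ≤ θ * (A_S * (24 * (((F.P K).L : ℝ) ^ j) ^ 2 * ((F.P K).L : ℝ) ^ h) / R)
              + η / 3 * ((A_B + A_B' * (2 * (R : ℝ) + 2 * ((F.P K).L : ℝ) ^ h)) * (4 * (((F.P K).L : ℝ) ^ j) ^ 2))) ∧
        (∑ x : Site (F.P K) 0, ∑ a, ∑ b, ((aT ⟨x.shift a, b⟩ - aT ⟨x, b⟩) - (aT ⟨x.shift b, a⟩ - aT ⟨x, a⟩)) ^ 2
            ≤ 328 * (8 * ((F.P K).L : ℝ) ^ j) + A_Q * (24 * (((F.P K).L : ℝ) ^ j) ^ 2 * ((F.P K).L : ℝ) ^ h) ^ 2 / ((R : ℝ) - 2) ^ 5) ∧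
        (∑ b : PBond (F.P K) 0, |aT b| ≤ (A_L + A_L' * (2 * (R : ℝ) + 1 + 2 * ((F.P K).L : ℝ) ^ h)) * (4 * (((F.P K).L : ℝ) ^ j) ^ 2)) ∧
        (∀ b : PBond (F.P K) 0, |aT b| ≤ A_T * (4 * (((F.P K).L : ℝ) ^ j) ^ 2)) := by
  obtain ⟨A_S, A_B, A_B', A_Q, A_L, A_L', A_T, hS, hB, hB', hQ, hL, hL', hT, hmain⟩ := exists_truncatedPotential_torus
  refine ⟨A_S, A_B, A_B', A_Q, A_L, A_L', A_T, hS, hB, hB', hQ, hL, hL', hT, ?_⟩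
  intro F K j h hjh hh μ ν hμν y Y hnest R hR hR12 hN
  have hj : j ≤ (F.P K).m + (F.P K).K := hjh.trans hh
  obtain ⟨C, hC⟩ := exists_corner F K hh Y
  obtain ⟨c, hc⟩ := exists_corner F K hj y
  -- the matched counting charge (free symbols as closed forms)
  obtain ⟨δ, hδ⟩ : ∃ δ : Zd (F.P K).d, ∀ i, δ i = ((y i).val : ℤ) * ((F.P K).L : ℤ) ^ j - ((Y i).val : ℤ) * ((F.P K).L : ℤ) ^ h :=
    ⟨fun i => ((y i).val : ℤ) * ((F.P K).L : ℤ) ^ j - ((Y i).val : ℤ) * ((F.P K).L : ℤ) ^ h, fun _ => rfl⟩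
  obtain ⟨ωj, hωj⟩ : ∃ ωj : Zd (F.P K).d → Fin (F.P K).d → Fin (F.P K).d → ℝ, ∀ w a b, ωj w a b = (((((F.P K).L : ℝ) ^ (F.P K).d) ^ j)⁻¹ *
      ((((Finset.univ : Finset (Fin (F.P K).d → Fin ((F.P K).L ^ j))) ×ˢ (Finset.range ((F.P K).L ^ j) ×ˢ Finset.range ((F.P K).L ^ j))).filter
        (fun τ => (fun i => ((τ.1 i : ℕ) : ℤ)) + (τ.2.1 : ℤ) • unitVec μ + (τ.2.2 : ℤ) • unitVec ν = w)).card : ℝ)) *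
      ((if a = μ ∧ b = ν then 1 else 0) - (if a = ν ∧ b = μ then 1 else 0)) := ⟨fun w a b => _, fun _ _ _ => rfl⟩
  obtain ⟨ωh, hωh⟩ : ∃ ωh : Zd (F.P K).d → Fin (F.P K).d → Fin (F.P K).d → ℝ, ∀ w a b, ωh w a b = (((((F.P K).L : ℝ) ^ (F.P K).d) ^ h)⁻¹ *
      ((((Finset.univ : Finset (Fin (F.P K).d → Fin ((F.P K).L ^ h))) ×ˢ (Finset.range ((F.P K).L ^ h) ×ˢ Finset.range ((F.P K).L ^ h))).filter
        (fun τ => (fun i => ((τ.1 i : ℕ) : ℤ)) + (τ.2.1 : ℤ) • unitVec μ + (τ.2.2 : ℤ) • unitVec ν = w)).card : ℝ)) *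
      ((if a = μ ∧ b = ν then 1 else 0) - (if a = ν ∧ b = μ then 1 else 0)) := ⟨fun w a b => _, fun _ _ _ => rfl⟩
  obtain ⟨ω, hω⟩ : ∃ ω : Zd (F.P K).d → Fin (F.P K).d → Fin (F.P K).d → ℝ,
      ∀ w a b, ω w a b = ωj (w - δ) a b - (((F.P K).L : ℝ) ^ j) ^ 2 / (((F.P K).L : ℝ) ^ h) ^ 2 * ωh w a b :=
    ⟨fun w a b => ωj (w - δ) a b - (((F.P K).L : ℝ) ^ j) ^ 2 / (((F.P K).L : ℝ) ^ h) ^ 2 * ωh w a b, fun _ _ _ => rfl⟩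
  obtain ⟨h0, hanti, h1, hM0, hHt⟩ := matched_counting_data hjh hμν y Y hnest δ hδ ωj ωh ω hωj hωh hω
  -- the masses in closed form (d = 3)
  have hd : (F.P K).d = 3 := rfl
  have hLpos : (0 : ℝ) < (F.P K).L := by exact_mod_cast (F.P K).L_pos
  have hcast : ((2 * (F.P K).L ^ h : ℕ) : ℤ) = 2 * ((F.P K).L : ℤ) ^ h := by push_cast; ring
  have hcastR : ((2 * (F.P K).L ^ h : ℕ) : ℝ) = 2 * ((F.P K).L : ℝ) ^ h := by push_cast; ring
  -- abbreviations for the two scales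
  obtain ⟨A, hA⟩ : ∃ A : ℝ, A = ((F.P K).L : ℝ) ^ j := ⟨_, rfl⟩
  obtain ⟨Bh, hBh⟩ : ∃ B : ℝ, B = ((F.P K).L : ℝ) ^ h := ⟨_, rfl⟩
  have hA0 : 0 < A := by rw [hA]; exact pow_pos hLpos j
  have hB0 : 0 < Bh := by rw [hBh]; exact pow_pos hLpos h
  have hAB : A ≤ Bh := by rw [hA, hBh]; exact pow_le_pow_right₀ (by exact_mod_cast (F.P K).L_pos) hjh
  have e_dj : (((F.P K).L : ℝ) ^ (F.P K).d) ^ j = A ^ 3 := by rw [hd, ← pow_mul, mul_comm, pow_mul, hA]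
  have e_dh : (((F.P K).L : ℝ) ^ (F.P K).d) ^ h = Bh ^ 3 := by rw [hd, ← pow_mul, mul_comm, pow_mul, hBh]
  have e_jd : (((F.P K).L : ℝ) ^ j) ^ (F.P K).d = A ^ 3 := by rw [hd, hA]
  have e_hd : (((F.P K).L : ℝ) ^ h) ^ (F.P K).d = Bh ^ 3 := by rw [hd, hBh]
  have e_j : ((F.P K).L : ℝ) ^ j = A := hA.symm
  have e_h : ((F.P K).L : ℝ) ^ h = Bh := hBh.symm
  -- M₀ ≤ 4A²
  have hM0' : ∑ a, ∑ b, ∑ w ∈ box (0 : Zd (F.P K).d) (2 * ((F.P K).L : ℤ) ^ h), |ω w a b| ≤ 4 * A ^ 2 := by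
    refine hM0.trans (le_of_eq ?_)
    simp only [e_dj, e_dh, e_jd, e_hd]
    simp only [e_j, e_h]
    rw [abs_of_pos (by positivity), abs_of_pos (by positivity), abs_of_pos (by positivity)]
    field_simp
    ring
  -- height ≤ 2/A
  have hHt' : ∀ w a b, |ω w a b| ≤ 2 * A⁻¹ := by
    intro w a b
    refine (hHt w a b).trans ?_
    simp only [e_dj, e_dh]
    simp only [e_j, e_h]
    rw [abs_of_pos (by positivity), abs_of_pos (by positivity), abs_of_pos (by positivity)]
    have t1 : (A ^ 3)⁻¹ * (A * A) = A⁻¹ := by field_simp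
    have t2 : A ^ 2 / Bh ^ 2 * ((Bh ^ 3)⁻¹ * (Bh * Bh)) = A ^ 2 / Bh ^ 3 := by field_simp
    have t3 : A ^ 2 / Bh ^ 3 ≤ A⁻¹ := by
      rw [inv_eq_one_div, div_le_div_iff₀ (by positivity) hA0, one_mul]
      calc A ^ 2 * A = A ^ 3 := by ring
        _ ≤ Bh ^ 3 := pow_le_pow_left₀ hA0.le hAB 3
    rw [t1, t2]; linarith
  -- W ≤ 8A
  have hW' : ∑ a, ∑ b, ∑ w ∈ box (0 : Zd (F.P K).d) (2 * ((F.P K).L : ℤ) ^ h), ω w a b ^ 2 ≤ 8 * A := by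
    calc ∑ a, ∑ b, ∑ w ∈ box (0 : Zd (F.P K).d) (2 * ((F.P K).L : ℤ) ^ h), ω w a b ^ 2
        ≤ ∑ a, ∑ b, ∑ w ∈ box (0 : Zd (F.P K).d) (2 * ((F.P K).L : ℤ) ^ h), (2 * A⁻¹) * |ω w a b| :=
          Finset.sum_le_sum fun a _ => Finset.sum_le_sum fun b _ => Finset.sum_le_sum fun w _ => by
            rw [← sq_abs, sq]; exact mul_le_mul_of_nonneg_right (hHt' w a b) (abs_nonneg _)
      _ = (2 * A⁻¹) * ∑ a, ∑ b, ∑ w ∈ box (0 : Zd (F.P K).d) (2 * ((F.P K).L : ℤ) ^ h), |ω w a b| := by simp only [Finset.mul_sum]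
      _ ≤ (2 * A⁻¹) * (4 * A ^ 2) := mul_le_mul_of_nonneg_left hM0' (by positivity)
      _ = 8 * A := by field_simp; ring
  -- M₁ ≤ 24A²·B
  have hM1' : ∑ a, ∑ b, ∑ w ∈ box (0 : Zd (F.P K).d) (2 * ((F.P K).L : ℤ) ^ h), (∑ i, |((w i - (0 : Zd (F.P K).d) i : ℤ) : ℝ)|) * |ω w a b|
      ≤ 24 * A ^ 2 * Bh := by
    refine (firstMoment_le_of_box ω (2 * ((F.P K).L : ℤ) ^ h)).trans ?_
    have hd3 : ((F.P K).d : ℝ) = 3 := by rw [hd]; norm_num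
    rw [hd3]; push_cast; rw [e_h]
    calc (3 : ℝ) * (2 * Bh) * ∑ a, ∑ b, ∑ w ∈ box (0 : Zd (F.P K).d) (2 * ((F.P K).L : ℤ) ^ h), |ω w a b|
        ≤ 3 * (2 * Bh) * (4 * A ^ 2) := mul_le_mul_of_nonneg_left hM0' (by positivity)
      _ = 24 * A ^ 2 * Bh := by ring
  have hM1nn : 0 ≤ ∑ a, ∑ b, ∑ w ∈ box (0 : Zd (F.P K).d) (2 * ((F.P K).L : ℤ) ^ h), (∑ i, |((w i - (0 : Zd (F.P K).d) i : ℤ) : ℝ)|) * |ω w a b| :=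
    Finset.sum_nonneg fun _ _ => Finset.sum_nonneg fun _ _ => Finset.sum_nonneg fun _ _ => by positivity
  -- FILE 5 at the matched charge
  have hω0' : ∀ x, x ∉ box (0 : Zd (F.P K).d) ((2 * (F.P K).L ^ h : ℕ) : ℤ) → ∀ a b, ω x a b = 0 := by
    intro x hx a b; rw [hcast] at hx; exact h0 x hx a b
  have hω1' : ∀ a b, ∑ w ∈ box (0 : Zd (F.P K).d) ((2 * (F.P K).L ^ h : ℕ) : ℤ), ω w a b = 0 := by
    intro a b; rw [hcast]; exact h1 a b
  obtain ⟨aT, h0T, hPT, hQT, hST, hTT⟩ := hmain F K C (2 * (F.P K).L ^ h) R ω hω0' hanti hω1' hR hR12 hN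
  simp only [hcast, hcastR] at hPT hQT hST hTT
  have hRpos : (0 : ℝ) < R := by exact_mod_cast (show 0 < R by omega)
  have hR12' : (12 : ℝ) ≤ R := by exact_mod_cast hR12
  have hR2pos : (0 : ℝ) < (R : ℝ) - 2 := by linarith
  -- rename the two scales in the goal and in FILE 5's rows
  simp only [e_j, e_h] at hPT hQT hST hTT ⊢
  refine ⟨C, aT, hC, h0T, ?_, ?_, ?_, ?_⟩
  · -- (P″)
    intro Φ θ η hθ hΦanti hΦb hdΦ
    have hη : 0 ≤ η := (abs_nonneg _).trans (hdΦ 0 (self_mem_box 0 (by positivity)) μ μ ν)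
    have hP := hPT Φ θ η hθ hΦb hdΦ
    have hpair := sum_matched_mul_eq hj hh hjh hμν y Y c C hc hC hnest δ hδ ((((F.P K).L : ℝ) ^ j) ^ 2 / (((F.P K).L : ℝ) ^ h) ^ 2)
      ωj ωh ω hωj hωh hω Φ hΦanti (show 2 * ((F.P K).L : ℤ) ^ h ≤ 2 * (R : ℤ) + 2 by
        have : ((2 * (2 * (F.P K).L ^ h) + 4 : ℕ) : ℤ) ≤ (R : ℤ) := by exact_mod_cast hR
        push_cast at this; linarith)
    simp only [e_j, e_h] at hpair
    erw [hpair] at hP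
    refine hP.trans (add_le_add ?_ ?_)
    · refine mul_le_mul_of_nonneg_left ?_ hθ
      exact div_le_div_of_nonneg_right (mul_le_mul_of_nonneg_left hM1' hS) hRpos.le
    · have hc0 : (0 : ℝ) ≤ A_B + A_B' * (2 * (R : ℝ) + 2 * Bh) := by positivity
      have hη3 : (0 : ℝ) ≤ η / 3 := by positivity
      exact mul_le_mul_of_nonneg_left (mul_le_mul_of_nonneg_left hM0' hc0) hη3
  · -- (Q″)
    refine hQT.trans (add_le_add (mul_le_mul_of_nonneg_left hW' (by norm_num)) ?_)
    have hpow : (∑ a, ∑ b, ∑ w ∈ box (0 : Zd (F.P K).d) (2 * ((F.P K).L : ℤ) ^ h),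
        (∑ i, |((w i - (0 : Zd (F.P K).d) i : ℤ) : ℝ)|) * |ω w a b|) ^ 2 ≤ (24 * A ^ 2 * Bh) ^ 2 := pow_le_pow_left₀ hM1nn hM1' 2
    have h5 : (0 : ℝ) < ((R : ℝ) - 2) ^ 5 := by positivity
    calc A_Q * (∑ a, ∑ b, ∑ w ∈ box (0 : Zd (F.P K).d) (2 * ((F.P K).L : ℤ) ^ h),
          (∑ i, |((w i - (0 : Zd (F.P K).d) i : ℤ) : ℝ)|) * |ω w a b|) ^ 2 / ((R : ℝ) - 2) ^ 5
        = A_Q * ((∑ a, ∑ b, ∑ w ∈ box (0 : Zd (F.P K).d) (2 * ((F.P K).L : ℤ) ^ h),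
          (∑ i, |((w i - (0 : Zd (F.P K).d) i : ℤ) : ℝ)|) * |ω w a b|) ^ 2 / ((R : ℝ) - 2) ^ 5) := by ring
      _ ≤ A_Q * ((24 * A ^ 2 * Bh) ^ 2 / ((R : ℝ) - 2) ^ 5) := mul_le_mul_of_nonneg_left (div_le_div_of_nonneg_right hpow h5.le) hQ
      _ = A_Q * (24 * A ^ 2 * Bh) ^ 2 / ((R : ℝ) - 2) ^ 5 := by ring
  · -- (S″)
    have hc0 : (0 : ℝ) ≤ A_L + A_L' * (2 * (R : ℝ) + 1 + 2 * Bh) := by positivity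
    exact hST.trans (mul_le_mul_of_nonneg_left hM0' hc0)
  · -- (T″)
    exact fun b => (hTT b).trans (mul_le_mul_of_nonneg_left hM0' hT)

end Summit.QuantumFields.YangMills.Theorems.CovariantDischargeProfileSocket

end
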